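import Summits.Ventures.HSemireg.WedgeHankelRecurrenceDual

/-!
# Venture HSemireg — THE SYMBOL OF A CLASS (Kronecker's theorem in full): **the middle rank of the dual class `dualSeq m a` is the degree of the REDUCED denominator of its symbol `a / m`,
# `R(dualSeq m a) = deg m − deg gcd(m, a)`, with minimal recurrence `m / gcd(m, a)`**; symbols add — `dualSeq m a + dualSeq m′ a′ = dualSeq (m m′) (a m′ + a′ m)` — so **the middle rank of a
# SUM of affine classes is the degree of the reduced denominator of `a / m + a′ / m′`** (N31's coprime additivity is the case of no cancellation; `q′ = −q` the case of total cancellation)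

HONEST FRAMING. Part of the Lean index of the computation cell `pub-hsemireg` (seat p10 gen 28, Sunday typer «UNIFORM-IN-n»).
LINEAR ALGEBRA OF HANKEL (catalecticant) MATRICES and of polynomials over a field ONLY: no variety, no cohomology theory, no sheaf, no Ext group and no semiregularity map is constructed
here; nothing here says that HC / HC_CM / HC_AV holds; no Literature fact is declared or used.  Custodian versions as in `WedgeHankelSiegelIdeal` (1/3); the dictionary (`dualSeq m a` =
the class of the proper rational function `a / m` expanded at `∞`, N32; «symbol» = that rational function; Kronecker 1881: the Hankel rank of a power series is the degree of the
denominator of the rational function it represents) is QUOTED, never asserted.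

WHAT IS IN THE TREE.  N32 (`WedgeHankelRecurrenceDual`, № 263): `dualSeq`, `dualSeq_add`, `dualSeq_mul_left` (`dualSeq (g m₁) (g a₁) = lc(g) • dualSeq m₁ a₁`),
`rank_hankel1_half_dualSeq_of_isCoprime`, `recSpace_dualSeq_self_eq_span_of_isCoprime`, `rank_hankel1_half_dualSeq_lt_of_not_isCoprime` (the strict inequality only); N34 (№ 267)
`rank_half_eq_and_mem_recSpace_iff_exists_affine` is NOT imported (this leaf is PLAIN on N32); N18 (№ 173): `recSpace_smul_seq`, `finrank_recSpace_add_rank`.  Mathlib: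
`EuclideanDomain.gcd_dvd_left/right`, `EuclideanDomain.gcd_eq_gcd_ab`, `isCoprime_mul_unit_right`, `IsCoprime.mul_left`, `IsCoprime.mul_right`, `IsCoprime.add_mul_left_right`,
`IsCoprime.isUnit_of_dvd'`, `Polynomial.natDegree_eq_zero_of_isUnit`, `Polynomial.monic_mul_leadingCoeff_inv`.
THIS FILE (namespace `Summit.Ventures.HSemireg.Wedge.HankelOuter` continued; PLAIN on N32; 0 definitions):
* §549 `rank_hankel1_smul_seq` (`c ≠ 0 ⇒ rank H_k(c • q) = rank H_k(q)`), **`dualSeq_mul_left_of_monic`** (a MONIC common factor cancels exactly: `dualSeq (g m₁) (g a₁) = dualSeq m₁ a₁`).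
* §550 KRONECKER, factorised form **`rank_hankel1_half_dualSeq_of_factor`** (`m = g m₁`, `a = g a₁`, `IsCoprime m₁ a₁`, `m₁` monic, `2 deg m₁ ≤ N + 1` ⇒ `R(dualSeq m a) = deg m₁` and
  `Rec_{deg m₁}(dualSeq m a) = K · m₁`); with the Euclidean gcd **`rank_hankel1_half_dualSeq_eq_sub_natDegree_gcd`** (`2 deg m ≤ N + 1 ⇒ R(dualSeq m a) = deg m − deg gcd(m, a)`;
  `isCoprime_of_gcd_mul` = coprimality after dividing by the gcd, from Bezout).
* §551 SUMS OF SYMBOLS: **`dualSeq_add_dualSeq`** (`dualSeq m a + dualSeq m′ a′ = dualSeq (m m′) (a m′ + a′ m)`), **`rank_hankel1_half_dualSeq_add_dualSeq`** (`2 deg(m m′) ≤ N + 1 ⇒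
  R = deg(m m′) − deg gcd(m m′, a m′ + a′ m)`), `isCoprime_mul_add_mul` + **`rank_hankel1_half_dualSeq_add_dualSeq_of_isCoprime`** (coprime denominators and unit numerators: no
  cancellation, `R = deg m + deg m′` — N31's additivity re-derived on dual classes), `dualSeq_add_dualSeq_neg_self` (total cancellation: `R = 0`).
READING: together with N34 (every affine class of rank `r ≤ (N+1)/2` IS `dualSeq m a` on `[0, N]` with `a` a unit mod `m`) this is the symbol calculus of the census range: classes are
proper rational functions of degree `≤ (N+1)/2`, the middle rank is the degree, sums are sums.  Gen 27 OPEN (γ) («`R(q+q′) = deg lcm − cancellation`») is this statement.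
Nothing Ext-side.  New names only.
-/

open Module Polynomial
open scoped Matrix Polynomial

namespace Summit.Ventures.HSemireg.Wedge.HankelOuter

open Summit.Ventures.HSemireg.Wedge Summit.Ventures.HSemireg.Wedge.Hankel

variable (K : Type*) [Field K] {N : ℕ}

/-! ## §549. Scalars and monic common factors do not change the class up to the obvious -/

/-- **a non-zero scalar keeps every Hankel rank: `rank H_k(c • q) = rank H_k(q)`** (same recurrence spaces, rank–nullity). -/
theorem rank_hankel1_smul_seq {c : K} (hc : c ≠ 0) (k : ℕ) (q : ℕ → K) : (hankel1 K N k (c • q)).rank = (hankel1 K N k q).rank := by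
  have h1 := finrank_recSpace_add_rank K (N := N) k (c • q)
  have h2 := finrank_recSpace_add_rank K (N := N) k q
  rw [recSpace_smul_seq K hc] at h1
  omega

/-- **A MONIC COMMON FACTOR CANCELS: `dualSeq (g · m₁) (g · a₁) = dualSeq m₁ a₁`** (`g`, `m₁` monic; N32 `dualSeq_mul_left` with `lc(g) = 1`): the symbol `g a₁ / g m₁ = a₁ / m₁`. -/
theorem dualSeq_mul_left_of_monic {g m₁ : K[X]} (hg : g.Monic) (hm₁ : m₁.Monic) (a₁ : K[X]) : dualSeq K (g * m₁) (g * a₁) = dualSeq K m₁ a₁ := by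
  rw [dualSeq_mul_left K hg.ne_zero hm₁ (hg.mul hm₁) a₁, hg.leadingCoeff, one_smul]

/-! ## §550. Kronecker's theorem: the middle rank is the degree of the reduced denominator -/

/-- **KRONECKER, FACTORISED FORM: if `m = g · m₁` and `a = g · a₁` with `m`, `m₁` monic and `a₁` a unit modulo `m₁` (`2 deg m₁ ≤ N + 1`), then `R(dualSeq m a) = deg m₁` and the
minimal recurrence of `dualSeq m a` is `m₁`: `Rec_{deg m₁}(dualSeq m a) = K · m₁`.** -/
theorem rank_hankel1_half_dualSeq_of_factor {m a g m₁ a₁ : K[X]} (hm : m.Monic) (hm₁ : m₁.Monic) (hmg : m = g * m₁) (hag : a = g * a₁) (hcop : IsCoprime m₁ a₁)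
    (h2 : m₁.natDegree + m₁.natDegree ≤ N + 1) :
    (hankel1 K N (N / 2) (dualSeq K m a)).rank = m₁.natDegree ∧ recSpace K N (dualSeq K m a) m₁.natDegree = K ∙ m₁ := by
  have hg0 : g ≠ 0 := fun h => hm.ne_zero (by rw [hmg, h, zero_mul])
  have hgm : (g * m₁).Monic := hmg ▸ hm
  have hlc : g.leadingCoeff ≠ 0 := Polynomial.leadingCoeff_ne_zero.mpr hg0
  have key : dualSeq K m a = g.leadingCoeff • dualSeq K m₁ a₁ := by rw [hmg, hag]; exact dualSeq_mul_left K hg0 hm₁ hgm a₁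
  rw [key, rank_hankel1_smul_seq K hlc, recSpace_smul_seq K hlc]
  exact ⟨rank_hankel1_half_dualSeq_of_isCoprime K hm₁ hcop h2, recSpace_dualSeq_self_eq_span_of_isCoprime K hm₁ hcop h2⟩

/-- dividing by the Euclidean gcd leaves coprime quotients (Bezout). -/
theorem isCoprime_of_gcd_mul [DecidableEq K] {m a m₁ a₁ : K[X]} (hg0 : EuclideanDomain.gcd m a ≠ 0) (hm : m = EuclideanDomain.gcd m a * m₁)
    (ha : a = EuclideanDomain.gcd m a * a₁) : IsCoprime m₁ a₁ := by
  set g := EuclideanDomain.gcd m a with hg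
  refine ⟨EuclideanDomain.gcdA m a, EuclideanDomain.gcdB m a, mul_left_cancel₀ hg0 ?_⟩
  have hb := EuclideanDomain.gcd_eq_gcd_ab m a
  rw [← hg] at hb
  calc g * (EuclideanDomain.gcdA m a * m₁ + EuclideanDomain.gcdB m a * a₁) = (g * m₁) * EuclideanDomain.gcdA m a + (g * a₁) * EuclideanDomain.gcdB m a := by ring
    _ = g * 1 := by rw [← hm, ← ha, mul_one, ← hb]

/-- **KRONECKER WITH THE GCD: for `m` monic and `2 deg m ≤ N + 1`, `R(dualSeq m a) = deg m − deg gcd(m, a)`** (the degree of the reduced denominator of the symbol `a / m`; N32 had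
`= deg m ↔ IsCoprime m a` and `< deg m` otherwise). -/
theorem rank_hankel1_half_dualSeq_eq_sub_natDegree_gcd [DecidableEq K] {m a : K[X]} (hm : m.Monic) (h2 : m.natDegree + m.natDegree ≤ N + 1) :
    (hankel1 K N (N / 2) (dualSeq K m a)).rank = m.natDegree - (EuclideanDomain.gcd m a).natDegree := by
  set g := EuclideanDomain.gcd m a with hg
  have hg0 : g ≠ 0 := fun h => hm.ne_zero ((EuclideanDomain.gcd_eq_zero_iff.mp h).1)
  obtain ⟨m₁', hm₁'⟩ : g ∣ m := EuclideanDomain.gcd_dvd_left m a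
  obtain ⟨a₁', ha₁'⟩ : g ∣ a := EuclideanDomain.gcd_dvd_right m a
  have hm₁'0 : m₁' ≠ 0 := fun h => hm.ne_zero (by rw [hm₁', h, mul_zero])
  have hcop' : IsCoprime m₁' a₁' := isCoprime_of_gcd_mul K hg0 hm₁' ha₁'
  -- normalise the quotient `m₁'` to a monic `m₁`, moving its leading coefficient into the common factor
  set u := m₁'.leadingCoeff with hu
  have hu0 : u ≠ 0 := Polynomial.leadingCoeff_ne_zero.mpr hm₁'0
  have hunit : IsUnit (Polynomial.C u⁻¹) := Polynomial.isUnit_C.mpr (Ne.isUnit (inv_ne_zero hu0))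
  have hm₁ : (m₁' * Polynomial.C u⁻¹).Monic := Polynomial.monic_mul_leadingCoeff_inv hm₁'0
  have hCC : Polynomial.C u * Polynomial.C u⁻¹ = 1 := by rw [← Polynomial.C_mul, mul_inv_cancel₀ hu0, Polynomial.C_1]
  have hmg : m = (g * Polynomial.C u) * (m₁' * Polynomial.C u⁻¹) := by
    rw [hm₁']; calc g * m₁' = g * m₁' * (Polynomial.C u * Polynomial.C u⁻¹) := by rw [hCC, mul_one]
      _ = (g * Polynomial.C u) * (m₁' * Polynomial.C u⁻¹) := by ring
  have hag : a = (g * Polynomial.C u) * (a₁' * Polynomial.C u⁻¹) := by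
    rw [ha₁']; calc g * a₁' = g * a₁' * (Polynomial.C u * Polynomial.C u⁻¹) := by rw [hCC, mul_one]
      _ = (g * Polynomial.C u) * (a₁' * Polynomial.C u⁻¹) := by ring
  have hcop : IsCoprime (m₁' * Polynomial.C u⁻¹) (a₁' * Polynomial.C u⁻¹) := (isCoprime_mul_unit_right hunit m₁' a₁').mpr hcop'
  have hdeg : (m₁' * Polynomial.C u⁻¹).natDegree = m.natDegree - g.natDegree := by
    rw [Polynomial.natDegree_mul_leadingCoeff_inv _ hm₁'0, hm₁', Polynomial.natDegree_mul hg0 hm₁'0, Nat.add_sub_cancel_left]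
  rw [← hdeg]
  exact (rank_hankel1_half_dualSeq_of_factor K hm hm₁ hmg hag hcop (by rw [hdeg]; omega)).1

/-! ## §551. Symbols add: the middle rank of a sum is the degree of the reduced denominator of the sum of the symbols -/

/-- a class modulo `m` is also a class modulo `m′ m`: `dualSeq m a = dualSeq (m′ · m) (m′ · a)` (`m`, `m′` monic). -/
theorem dualSeq_eq_dualSeq_mul_left {m m' : K[X]} (hm : m.Monic) (hm' : m'.Monic) (a : K[X]) : dualSeq K m a = dualSeq K (m' * m) (m' * a) :=
  (dualSeq_mul_left_of_monic K hm' hm a).symm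

/-- **SYMBOLS ADD: `dualSeq m a + dualSeq m′ a′ = dualSeq (m · m′) (a · m′ + a′ · m)`** (`m`, `m′` monic) — `a / m + a′ / m′ = (a m′ + a′ m) / (m m′)`. -/
theorem dualSeq_add_dualSeq {m m' : K[X]} (hm : m.Monic) (hm' : m'.Monic) (a a' : K[X]) :
    dualSeq K m a + dualSeq K m' a' = dualSeq K (m * m') (a * m' + a' * m) := by
  have h1 : dualSeq K (m * m') (a * m') = dualSeq K m a := by rw [mul_comm m m', mul_comm a m']; exact dualSeq_mul_left_of_monic K hm' hm a
  have h2 : dualSeq K (m * m') (a' * m) = dualSeq K m' a' := by rw [mul_comm a' m]; exact dualSeq_mul_left_of_monic K hm hm' a'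
  rw [dualSeq_add, h1, h2]

/-- **THE MIDDLE RANK OF A SUM OF DUAL CLASSES is the degree of the reduced denominator of the sum of the symbols: for `m`, `m′` monic and `2 deg(m m′) ≤ N + 1`,
`R(dualSeq m a + dualSeq m′ a′) = deg(m m′) − deg gcd(m m′, a m′ + a′ m)`.** -/
theorem rank_hankel1_half_dualSeq_add_dualSeq [DecidableEq K] {m m' : K[X]} (hm : m.Monic) (hm' : m'.Monic) (a a' : K[X])
    (h2 : (m * m').natDegree + (m * m').natDegree ≤ N + 1) :
    (hankel1 K N (N / 2) (dualSeq K m a + dualSeq K m' a')).rank = (m * m').natDegree - (EuclideanDomain.gcd (m * m') (a * m' + a' * m)).natDegree := by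
  rw [dualSeq_add_dualSeq K hm hm']
  exact rank_hankel1_half_dualSeq_eq_sub_natDegree_gcd K (hm.mul hm') h2

/-- no cancellation: coprime denominators and unit numerators give a numerator `a m′ + a′ m` prime to `m m′`. -/
theorem isCoprime_mul_add_mul {m m' a a' : K[X]} (hmm' : IsCoprime m m') (hma : IsCoprime m a) (hm'a' : IsCoprime m' a') : IsCoprime (m * m') (a * m' + a' * m) := by
  refine IsCoprime.mul_left ?_ ?_
  · rw [mul_comm a' m]
    exact (hma.mul_right hmm').add_mul_left_right a'
  · rw [add_comm, mul_comm a m']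
    exact (hm'a'.mul_right hmm'.symm).add_mul_left_right a

/-- the gcd of a coprime pair has degree `0`. -/
theorem natDegree_gcd_eq_zero_of_isCoprime [DecidableEq K] {x y : K[X]} (h : IsCoprime x y) : (EuclideanDomain.gcd x y).natDegree = 0 :=
  Polynomial.natDegree_eq_zero_of_isUnit (h.isUnit_of_dvd' (EuclideanDomain.gcd_dvd_left x y) (EuclideanDomain.gcd_dvd_right x y))

/-- **NO CANCELLATION ⇒ ADDITIVITY: for `m`, `m′` monic and coprime, `a`, `a′` units modulo `m`, `m′`, and `2(deg m + deg m′) ≤ N + 1`, `R(dualSeq m a + dualSeq m′ a′) = deg m + deg m′`**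
(N31's `rank_hankel1_half_add_eq_of_isCoprime`, re-derived on dual classes from the symbol calculus). -/
theorem rank_hankel1_half_dualSeq_add_dualSeq_of_isCoprime [DecidableEq K] {m m' a a' : K[X]} (hm : m.Monic) (hm' : m'.Monic) (hmm' : IsCoprime m m') (hma : IsCoprime m a)
    (hm'a' : IsCoprime m' a') (h2 : (m.natDegree + m'.natDegree) + (m.natDegree + m'.natDegree) ≤ N + 1) :
    (hankel1 K N (N / 2) (dualSeq K m a + dualSeq K m' a')).rank = m.natDegree + m'.natDegree := by
  have hdeg : (m * m').natDegree = m.natDegree + m'.natDegree := Polynomial.natDegree_mul hm.ne_zero hm'.ne_zero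
  rw [rank_hankel1_half_dualSeq_add_dualSeq K hm hm' a a' (by rw [hdeg]; exact h2), natDegree_gcd_eq_zero_of_isCoprime K (isCoprime_mul_add_mul K hmm' hma hm'a'), hdeg, Nat.sub_zero]

/-- **TOTAL CANCELLATION: `dualSeq m a + dualSeq m (−a) = 0`** (the symbols `a / m` and `−a / m` cancel; middle rank `0`). -/
theorem dualSeq_add_dualSeq_neg_self (m a : K[X]) : dualSeq K m a + dualSeq K m (-a) = 0 := by
  rw [← dualSeq_add, add_neg_cancel]
  funext j
  rw [dualSeq_apply, mul_zero, Polynomial.zero_modByMonic, Polynomial.coeff_zero, Pi.zero_apply]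

end Summit.Ventures.HSemireg.Wedge.HankelOuter
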